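import Summits.CriticalPhenomena.SAWScalingLimit.Theorems.SubseqIdentification.Negative.NonVacuity
import Summits.CriticalPhenomena.SAWScalingLimit.Theorems.SimpleSubseqLimits.Negative.SimpleSubseqLimitsHonesty
import Summits.CriticalPhenomena.SAWScalingLimit.Theorems.SimpleSubseqLimits.Negative.SimpleSubseqLimitsNecessary
import Literature.Probability.RandomPlanarGeometry.SimpleCurves

/-!
# drefute gen 2 — stmt-CriticalPhenomena-4982 / line `marked-point-revisit`: the lattice stub `NoTouchAt`
is NECESSARY for the crux modulo `EventualTight` (corollary of the landed necessity principle p84995 — STANDALONE copy: the landed theorems are repeated in namespace `…MarkedPointRevisit.TN` because the farm had not yet built the new module when this file was checked)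

`stub_onePointNoTouch_of_crux_of_eventualTight :
  EventualTight → SimpleSubseqLimits → ∀ D a b, SAW.IsEndpointApprox D a b → NoTouchAt D a b`,
with `NearRevisit`, `nearRevisitEvent`, `latticeCurve`, `NoTouchAt` VERBATIM from the reshaped skeleton
(`Lines/marked-point-revisit.lean`, sha 909bc12e…) in the skeleton's namespace, so the statement is about
the registered stub 5. Instance of
`Negative.exists_limsup_law_le_of_crux_of_not_simple` (landed, `SimpleSubseqLimitsThickeningNecessity`)
with `F n = closure (nearRevisitEvent z r ((r+R)/2) (R+1) (1/(n+1)))`; the core fact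
`⋂ₙ F n ∩ simple = ∅` (needs the gap `r < R₁`) and the reparametrisation invariance are the gen-1
drefuter's lemmas (`DrefuteReshapedStubs.lean`, copied verbatim with attribution). Also re-derived in
one line each: the gen-1 certificate `stub_onePointNoTouch_of_sawScalingLimit` (summit ⇒ stub 5).

So stub 5 is pinned from both sides: summit ⇒ NoTouchAt, and (T ∧ crux) ⇒ NoTouchAt; with the line's
composition (NoTouchAt + SHAPE ⇒ crux, relative to the A-side) the lattice input is EXACTLY the ORDER
content of the crux in truth value. Evidence file (not a landing: positive stub-level statements are the
provers'), rc 0, 0 sorry.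
-/

noncomputable section

open MeasureTheory Filter Topology Set Metric
open Literature.Probability.RandomPlanarGeometry Literature.Probability.LatticeModels
open scoped ENNReal NNReal BoundedContinuousFunction unitInterval

namespace Summit.CriticalPhenomena.SAWScalingLimit.Cruxes.SimpleSubseqLimits.MarkedPointRevisit

open Summit.CriticalPhenomena.SAWScalingLimit.Theses.SAWLoopFugacityFlow
  (SimpleSubseqLimits EventualTight)
open Summit.CriticalPhenomena.SAWScalingLimit.Theorems.SimpleSubseqLimits.Negative
  (Carrier WeakLimitAlong ae_carrier_of_isSLELaw)
open Summit.CriticalPhenomena.SAWScalingLimit.Theorems.SubseqIdentification.Negative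
  (exists_subseqConv_of_isTightAlongMesh isTightAlongMesh_of_eventualTight)
open Literature.Probability.RandomPlanarGeometry.SAW (law IsEndpointApprox DomainSAW)

/-! ## Copies of the landed necessity principle (p84995, `Negative.SimpleSubseqLimitsThickeningNecessity`) -/
namespace TN

variable {D : DobrushinDomain} {a b : ℝ → Site 2}

/-- **Portmanteau along a weakly convergent mesh sequence, closed sets.** If the test integrals of
the critical SAW laws along `s` converge to those of a finite measure `ν`, then for every closed
`F ⊆ CurveClass ℂ`, `limsup_n P_{s n}[curve ∈ F] ≤ ν F` (the laws are finite measures for every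
mesh, so no honesty hypothesis is needed). [folklore] -/
theorem limsup_law_closed_le_of_weakLimitAlong {s : ℕ → ℝ} {ν : Measure (CurveClass ℂ)}
    [IsFiniteMeasure ν] (hw : WeakLimitAlong D a b s ν) {F : Set (CurveClass ℂ)}
    (hF : IsClosed F) :
    limsup (fun n => law D.carrier (s n) (a (s n)) (b (s n)) {γ | γ.curve ∈ F}) atTop ≤ ν F := by
  let μs : ℕ → FiniteMeasure (CurveClass ℂ) := fun n =>
    ⟨(law D.carrier (s n) (a (s n)) (b (s n))).map (fun γ => γ.curve), inferInstance⟩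
  let μ : FiniteMeasure (CurveClass ℂ) := ⟨ν, inferInstance⟩
  have hlim : Tendsto μs atTop (𝓝 μ) := by
    rw [FiniteMeasure.tendsto_iff_forall_integral_tendsto]
    intro f
    refine (hw f).congr fun n => ?_
    change _ = ∫ x, f x ∂((law D.carrier (s n) (a (s n)) (b (s n))).map (fun γ => γ.curve))
    rw [integral_map (DomainSAW.measurable_of_top _).aemeasurable
      f.continuous.aestronglyMeasurable]
  have hport := FiniteMeasure.limsup_measure_closed_le_of_tendsto hlim hF
  refine le_trans (le_of_eq (limsup_congr (Eventually.of_forall fun n => ?_))) hport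
  change _ = ((law D.carrier (s n) (a (s n)) (b (s n))).map (fun γ => γ.curve)) F
  rw [Measure.map_apply (DomainSAW.measurable_of_top _) hF.measurableSet]
  rfl

/-- **No thickened lattice input is over-strong: `(∗)` follows from the summit conjunct.** Under
`SAWScalingLimit` (LSW Prediction 1 as typed), for every endpoint approximation, every decreasing
sequence of closed sets `F n` whose intersection contains no carrier class, and every `θ > 0`, some
`F n` has `limsup_{δ → 0⁺} P_δ[curve ∈ F n] ≤ θ`. [folklore] -/
theorem exists_limsup_law_le_of_sawScalingLimit (h : _root_.SAWScalingLimit)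
    (hab : IsEndpointApprox D a b) {F : ℕ → Set (CurveClass ℂ)} (hF : ∀ n, IsClosed (F n))
    (hanti : Antitone F) (hcore : ∀ c : CurveClass ℂ, (∀ n, c ∈ F n) → ¬ Carrier D c)
    {θ : ℝ≥0∞} (hθ : 0 < θ) :
    ∃ n, limsup (fun δ => law D.carrier δ (a δ) (b δ) {γ | γ.curve ∈ F n}) (𝓝[>] (0 : ℝ)) ≤ θ := by
  obtain ⟨Γ, hΓ, -, hT⟩ := h D a b hab
  haveI : Fact Literature.Probability.Process.isProjectiveLimit_preWienerMeasure :=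
    ⟨isProjectiveLimit_preWienerMeasure_holds⟩
  set μ : Measure (CurveClass ℂ) := Literature.Probability.Process.preWienerMeasure.map Γ with hμdef
  have hμ : IsSLELaw ((8 : ℝ≥0) / 3) D μ := ⟨Γ, hΓ, rfl⟩
  haveI := hμ.isProbabilityMeasure
  have hlimF := tendsto_measure_iInter_atTop (μ := μ)
    (fun n : ℕ => (hF n).measurableSet.nullMeasurableSet) hanti ⟨0, measure_ne_top μ _⟩
  have h0 : μ (⋂ n : ℕ, F n) = 0 := by
    have hae := ae_carrier_of_isSLELaw hμ
    rw [ae_iff] at hae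
    exact measure_mono_null (fun c hc hcar => hcore c (mem_iInter.1 hc) hcar) hae
  rw [h0] at hlimF
  obtain ⟨n, hn⟩ := ((tendsto_order.1 hlimF).2 θ hθ).exists
  refine ⟨n, ?_⟩
  let μs : ℝ → FiniteMeasure (CurveClass ℂ) := fun δ =>
    ⟨(law D.carrier δ (a δ) (b δ)).map (fun γ => γ.curve), inferInstance⟩
  let μf : FiniteMeasure (CurveClass ℂ) := ⟨μ, inferInstance⟩
  have hlim : Tendsto μs (𝓝[>] (0 : ℝ)) (𝓝 μf) := by
    rw [FiniteMeasure.tendsto_iff_forall_integral_tendsto]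
    intro f
    have hh := hT f
    rw [← integral_map hΓ.aemeasurable f.continuous.aestronglyMeasurable] at hh
    refine hh.congr fun δ => ?_
    change _ = ∫ x, f x ∂((law D.carrier δ (a δ) (b δ)).map (fun γ => γ.curve))
    rw [integral_map (DomainSAW.measurable_of_top _).aemeasurable
      f.continuous.aestronglyMeasurable]
  have hport := FiniteMeasure.limsup_measure_closed_le_of_tendsto hlim (hF n)
  calc limsup (fun δ => law D.carrier δ (a δ) (b δ) {γ | γ.curve ∈ F n}) (𝓝[>] (0 : ℝ))
      = limsup (fun δ => ((μs δ : FiniteMeasure (CurveClass ℂ)) : Measure (CurveClass ℂ)) (F n))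
          (𝓝[>] (0 : ℝ)) := by
        refine limsup_congr (Eventually.of_forall fun δ => ?_)
        change _ = ((law D.carrier δ (a δ) (b δ)).map (fun γ => γ.curve)) (F n)
        rw [Measure.map_apply (DomainSAW.measurable_of_top _) (hF n).measurableSet]
        rfl
    _ ≤ (μf : Measure (CurveClass ℂ)) (F n) := hport
    _ ≤ θ := hn.le

/-- **NECESSITY PRINCIPLE: `(∗)` follows from the crux itself, modulo `EventualTight`.** If the
pushed-forward critical SAW laws are eventually tight (route item `EventualTight`,
stmt-CriticalPhenomena-1372) and the crux `SimpleSubseqLimits` holds, then for every endpoint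
approximation, every decreasing sequence of closed sets `F n ⊆ CurveClass ℂ` whose intersection
contains no carrier class, and every `θ > 0`, some `F n` has `limsup_{δ → 0⁺} P_δ[curve ∈ F n] ≤ θ`.
Proof: otherwise meshes `δₙ ∈ (0, 1/(n+1))` with `θ < P_{δₙ}[F n]` (`frequently_lt_of_lt_limsup`)
carry a subsequential weak limit `ν` (Prokhorov under tightness), `θ ≤ ν (F m)` for every `m`
(portmanteau for the closed `F m`, monotonicity of `F`), hence `θ ≤ ν (⋂ F m)`; but the crux puts
`ν` on the carrier, which misses `⋂ F m`. [folklore] -/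
theorem exists_limsup_law_le_of_crux (hT : EventualTight) (hS : SimpleSubseqLimits)
    (hab : IsEndpointApprox D a b) {F : ℕ → Set (CurveClass ℂ)} (hF : ∀ n, IsClosed (F n))
    (hanti : Antitone F) (hcore : ∀ c : CurveClass ℂ, (∀ n, c ∈ F n) → ¬ Carrier D c)
    {θ : ℝ≥0∞} (hθ : 0 < θ) :
    ∃ n, limsup (fun δ => law D.carrier δ (a δ) (b δ) {γ | γ.curve ∈ F n}) (𝓝[>] (0 : ℝ)) ≤ θ := by
  by_contra hcon
  push Not at hcon
  -- meshes `δₙ ∈ (0, 1/(n+1))` with `θ < P_{δₙ}[F n]`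
  have hex : ∀ n : ℕ, ∃ δ : ℝ, θ < law D.carrier δ (a δ) (b δ) {γ | γ.curve ∈ F n} ∧
      δ ∈ Ioo (0 : ℝ) (1 / ((n : ℝ) + 1)) := by
    intro n
    have hfr : ∃ᶠ δ in 𝓝[>] (0 : ℝ), θ < law D.carrier δ (a δ) (b δ) {γ | γ.curve ∈ F n} :=
      frequently_lt_of_lt_limsup (by isBoundedDefault) (hcon n)
    exact (hfr.and_eventually (Ioo_mem_nhdsGT (by positivity))).exists
  choose s hsθ hsI using hex
  have hs : Tendsto s atTop (𝓝[>] (0 : ℝ)) := by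
    refine tendsto_nhdsWithin_iff.2 ⟨?_, Eventually.of_forall fun n => (hsI n).1⟩
    exact squeeze_zero (fun n => (hsI n).1.le) (fun n => (hsI n).2.le)
      tendsto_one_div_add_atTop_nhds_zero_nat
  -- a subsequential weak limit along `s` (Prokhorov under `EventualTight`)
  have hT' : Summit.CriticalPhenomena.SAWScalingLimit.Theses.SAWRenewalTightness.EventualTight :=
    fun D a b h => hT D a b h
  obtain ⟨φ, ν, hφ, hν, hlim⟩ :=
    exists_subseqConv_of_isTightAlongMesh hab (isTightAlongMesh_of_eventualTight hT' hab) hs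
  -- the crux: `ν` lives on the carrier
  have hcar : ∀ᵐ c ∂ν, Carrier D c :=
    hS D a b hab (s ∘ φ) ν (hs.comp hφ.tendsto_atTop) hν hlim
  have hw : WeakLimitAlong D a b (s ∘ φ) ν := hlim
  -- portmanteau along the subsequence: `θ ≤ ν (F m)` for every `m`
  have hθle : ∀ m, θ ≤ ν (F m) := by
    intro m
    refine le_trans ?_ (limsup_law_closed_le_of_weakLimitAlong hw (hF m))
    refine le_limsup_of_frequently_le' ?_
    refine ((eventually_ge_atTop m).mono fun k hk => ?_).frequently
    have hφk : m ≤ φ k := hk.trans (hφ.id_le k)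
    calc θ ≤ law D.carrier (s (φ k)) (a (s (φ k))) (b (s (φ k))) {γ | γ.curve ∈ F (φ k)} :=
          (hsθ (φ k)).le
      _ ≤ law D.carrier (s (φ k)) (a (s (φ k))) (b (s (φ k))) {γ | γ.curve ∈ F m} :=
          measure_mono fun γ hγ => hanti hφk hγ
  -- continuity from above: `θ ≤ ν (⋂ F m) = 0`
  have hlimF := tendsto_measure_iInter_atTop (μ := ν)
    (fun n : ℕ => (hF n).measurableSet.nullMeasurableSet) hanti ⟨0, measure_ne_top ν _⟩
  have hge : θ ≤ ν (⋂ n : ℕ, F n) := ge_of_tendsto' hlimF fun m => hθle m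
  have h0 : ν (⋂ n : ℕ, F n) = 0 := by
    rw [ae_iff] at hcar
    exact measure_mono_null (fun c hc hcar' => hcore c (mem_iInter.1 hc) hcar') hcar
  rw [h0] at hge
  exact lt_irrefl _ (hθ.trans_le hge)

/-- The necessity principle with the weaker core hypothesis used by the ORDER stubs: the
intersection of the thickenings contains no SIMPLE class. [folklore] -/
theorem exists_limsup_law_le_of_crux_of_not_simple (hT : EventualTight) (hS : SimpleSubseqLimits)
    (hab : IsEndpointApprox D a b) {F : ℕ → Set (CurveClass ℂ)} (hF : ∀ n, IsClosed (F n))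
    (hanti : Antitone F) (hcore : ∀ c : CurveClass ℂ, (∀ n, c ∈ F n) → c ∉ CurveClass.simple)
    {θ : ℝ≥0∞} (hθ : 0 < θ) :
    ∃ n, limsup (fun δ => law D.carrier δ (a δ) (b δ) {γ | γ.curve ∈ F n}) (𝓝[>] (0 : ℝ)) ≤ θ :=
  exists_limsup_law_le_of_crux hT hS hab hF hanti (fun c hc hcar => hcore c hc hcar.1) hθ

/-- The summit version with the weaker core hypothesis (no simple class in the intersection).
[folklore] -/
theorem exists_limsup_law_le_of_sawScalingLimit_of_not_simple (h : _root_.SAWScalingLimit)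
    (hab : IsEndpointApprox D a b) {F : ℕ → Set (CurveClass ℂ)} (hF : ∀ n, IsClosed (F n))
    (hanti : Antitone F) (hcore : ∀ c : CurveClass ℂ, (∀ n, c ∈ F n) → c ∉ CurveClass.simple)
    {θ : ℝ≥0∞} (hθ : 0 < θ) :
    ∃ n, limsup (fun δ => law D.carrier δ (a δ) (b δ) {γ | γ.curve ∈ F n}) (𝓝[>] (0 : ℝ)) ≤ θ :=
  exists_limsup_law_le_of_sawScalingLimit h hab hF hanti (fun c hc hcar => hcore c hc hcar.1) hθ

end TN

open TN (exists_limsup_law_le_of_crux_of_not_simple exists_limsup_law_le_of_sawScalingLimit_of_not_simple)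

/-! ## Vocabulary (verbatim from the reshaped skeleton) -/

/-- verbatim -/
def NearRevisit (γ : Curve ℂ) (z : ℂ) (r R₁ R₂ ε : ℝ) : Prop :=
  ∃ lam T t' : I, lam < T ∧ T < t' ∧ R₁ < dist (γ lam) z ∧
    (∀ u : I, lam ≤ u → u ≤ T → dist (γ u) z < R₂) ∧ dist (γ T) z < r ∧
    (∀ u : I, u ≤ lam → r < dist (γ u) z) ∧ dist (γ t') (γ lam) < ε

/-- verbatim -/
def nearRevisitEvent (z : ℂ) (r R₁ R₂ ε : ℝ) : Set (CurveClass ℂ) :=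
  {c | ∃ γ : Curve ℂ, CurveClass.mk γ = c ∧ NearRevisit γ z r R₁ R₂ ε}

/-- verbatim -/
def latticeCurve {Ω : Set ℂ} {δ : ℝ} {u v : Site 2} (γ : SAW.DomainSAW Ω δ u v) : Curve ℂ :=
  ⟨γ.walk.toCurve (meshPoint δ)⟩

@[simp] theorem mk_latticeCurve {Ω : Set ℂ} {δ : ℝ} {u v : Site 2} (γ : SAW.DomainSAW Ω δ u v) :
    CurveClass.mk (latticeCurve γ) = γ.curve := rfl

/-- verbatim -/
def NoTouchAt (D : DobrushinDomain) (a b : ℝ → Site 2) : Prop :=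
  ∀ (z : ℂ) (r R : ℝ), 0 < r → r < R → ∀ θ : ℝ≥0∞, 0 < θ →
    ∃ ε R₁ R₂ : ℝ, 0 < ε ∧ r < R₁ ∧ R₁ < R ∧ R < R₂ ∧
      limsup (fun δ : ℝ => SAW.law D.carrier δ (a δ) (b δ)
          {γ | NearRevisit (latticeCurve γ) z r R₁ R₂ ε}) (𝓝[>] (0 : ℝ)) ≤ θ

/-! ## Gen-1 drefuter's lemmas (verbatim from `DrefuteReshapedStubs.lean`) -/

theorem nearRevisit_reparam {γ : Curve ℂ} {z : ℂ} {r R₁ R₂ ε : ℝ}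
    (h : NearRevisit γ z r R₁ R₂ ε) (φ : I ≃o I) : NearRevisit (γ.reparam φ) z r R₁ R₂ ε := by
  obtain ⟨lam, T, t', hlt, hTt, hann, hin, hT, hfar, hd⟩ := h
  refine ⟨φ.symm lam, φ.symm T, φ.symm t', φ.symm.lt_iff_lt.2 hlt, φ.symm.lt_iff_lt.2 hTt,
    ?_, ?_, ?_, ?_, ?_⟩
  · show R₁ < dist (γ (φ (φ.symm lam))) z; rw [φ.apply_symm_apply]; exact hann
  · intro u h1 h2
    show dist (γ (φ u)) z < R₂
    exact hin (φ u) (by simpa using φ.monotone h1) (by simpa using φ.monotone h2)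
  · show dist (γ (φ (φ.symm T))) z < r; rw [φ.apply_symm_apply]; exact hT
  · intro u hu
    show r < dist (γ (φ u)) z
    exact hfar (φ u) (by simpa using φ.monotone hu)
  · show dist (γ (φ (φ.symm t'))) (γ (φ (φ.symm lam))) < ε
    rw [φ.apply_symm_apply, φ.apply_symm_apply]; exact hd

theorem nearRevisit_mono {γ : Curve ℂ} {z : ℂ} {r R₁ R₂ ε ε' : ℝ}
    (h : NearRevisit γ z r R₁ R₂ ε) (hε : ε ≤ ε') : NearRevisit γ z r R₁ R₂ ε' := by
  obtain ⟨lam, T, t', hlt, hTt, hann, hin, hT, hfar, hd⟩ := h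
  exact ⟨lam, T, t', hlt, hTt, hann, hin, hT, hfar, hd.trans_le hε⟩

/-- A simple class lies in the closures of the thickened events for all `ε = 1/(n+1)` only if
`R₁ ≤ r`. -/
theorem not_mem_closure_nearRevisitEvent_forall_of_simple {z : ℂ} {r R₁ R₂ : ℝ}
    (h₁ : r < R₁) {c : CurveClass ℂ} (hc : c ∈ CurveClass.simple)
    (h : ∀ n : ℕ, c ∈ closure (nearRevisitEvent z r R₁ R₂ (1 / ((n : ℝ) + 1)))) : False := by
  obtain ⟨η, hη, rfl⟩ := hc
  have hex : ∀ n : ℕ, ∃ γ : Curve ℂ, NearRevisit γ z r R₁ R₂ (1 / ((n : ℝ) + 1)) ∧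
      ∀ t, dist (η t) (γ t) < 1 / ((n : ℝ) + 1) := by
    intro n
    obtain ⟨b, hb, hd⟩ := Metric.mem_closure_iff.1 (h n) _ (by positivity : (0 : ℝ) < 1 / ((n : ℝ) + 1))
    obtain ⟨γ, rfl, hγ⟩ := hb
    change dist (SeparationQuotient.mk η) (SeparationQuotient.mk γ) < _ at hd
    rw [SeparationQuotient.dist_mk] at hd
    obtain ⟨φ, hφ⟩ := Curve.exists_dist_reparam_lt hd
    exact ⟨γ.reparam φ, nearRevisit_reparam hγ φ,
      fun t => (ContinuousMap.dist_apply_le_dist t).trans_lt hφ⟩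
  choose γ hγ hclose using hex
  choose lam T t' hlt hTt hann hin hT hfar hdist using hγ
  obtain ⟨⟨lam₀, T₀, t₀⟩, ψ, hψ, hlim⟩ :=
    CompactSpace.tendsto_subseq (fun n => (lam n, T n, t' n))
  have hlam : Tendsto (fun k => lam (ψ k)) atTop (𝓝 lam₀) :=
    (continuous_fst.tendsto _).comp hlim
  have hTl : Tendsto (fun k => T (ψ k)) atTop (𝓝 T₀) :=
    (continuous_fst.comp continuous_snd).tendsto _ |>.comp hlim
  have htl : Tendsto (fun k => t' (ψ k)) atTop (𝓝 t₀) :=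
    (continuous_snd.comp continuous_snd).tendsto _ |>.comp hlim
  have herr : Tendsto (fun k : ℕ => 1 / ((ψ k : ℝ) + 1)) atTop (𝓝 0) := by
    have h1 : Tendsto (fun k : ℕ => 1 / ((k : ℝ) + 1)) atTop (𝓝 0) :=
      tendsto_one_div_add_atTop_nhds_zero_nat
    refine squeeze_zero (fun k => by positivity) (fun k => ?_) h1
    have : (k : ℝ) ≤ ψ k := by exact_mod_cast hψ.id_le k
    exact one_div_le_one_div_of_le (by positivity) (by linarith)
  have hval : ∀ {u : ℕ → I} {u₀ : I}, Tendsto (fun k => u (ψ k)) atTop (𝓝 u₀) →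
      Tendsto (fun k => γ (ψ k) (u (ψ k))) atTop (𝓝 (η u₀)) := by
    intro u u₀ hu
    rw [tendsto_iff_dist_tendsto_zero]
    have h2 : Tendsto (fun k => dist (η (u (ψ k))) (η u₀)) atTop (𝓝 0) := by
      rw [← tendsto_iff_dist_tendsto_zero]
      exact (η.continuous.tendsto u₀).comp hu
    refine squeeze_zero (fun k => dist_nonneg) (fun k => ?_)
      (by simpa only [add_zero] using herr.add h2)
    calc dist (γ (ψ k) (u (ψ k))) (η u₀)
        ≤ dist (γ (ψ k) (u (ψ k))) (η (u (ψ k))) + dist (η (u (ψ k))) (η u₀) := dist_triangle _ _ _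
      _ ≤ 1 / ((ψ k : ℝ) + 1) + dist (η (u (ψ k))) (η u₀) := by
          gcongr; rw [dist_comm]; exact (hclose (ψ k) _).le
  have hvlam := hval hlam
  have hvT := hval hTl
  have hvt := hval htl
  have ha : R₁ ≤ dist (η lam₀) z :=
    ge_of_tendsto' (hvlam.dist tendsto_const_nhds) fun k => (hann (ψ k)).le
  have hb : dist (η T₀) z ≤ r :=
    le_of_tendsto' (hvT.dist tendsto_const_nhds) fun k => (hT (ψ k)).le
  have hc' : η t₀ = η lam₀ := by
    have hh1 : Tendsto (fun k => dist (γ (ψ k) (t' (ψ k))) (γ (ψ k) (lam (ψ k)))) atTop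
        (𝓝 (dist (η t₀) (η lam₀))) := hvt.dist hvlam
    have hh2 : Tendsto (fun k => dist (γ (ψ k) (t' (ψ k))) (γ (ψ k) (lam (ψ k)))) atTop (𝓝 0) :=
      squeeze_zero (fun k => dist_nonneg) (fun k => (hdist (ψ k)).le) herr
    exact dist_eq_zero.1 (tendsto_nhds_unique hh1 hh2)
  have hd1 : lam₀ ≤ T₀ := le_of_tendsto_of_tendsto' hlam hTl fun k => (hlt (ψ k)).le
  have hd2 : T₀ ≤ t₀ := le_of_tendsto_of_tendsto' hTl htl fun k => (hTt (ψ k)).le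
  have he : t₀ = lam₀ := hη hc'
  have hTeq : T₀ = lam₀ := le_antisymm (he ▸ hd2) hd1
  rw [hTeq] at hb
  linarith

/-! ## The closed thickenings of the line and their core -/

/-- The closed `1/(n+1)`-thickenings used by the line. -/
def thick (z : ℂ) (r R₁ R₂ : ℝ) (n : ℕ) : Set (CurveClass ℂ) :=
  closure (nearRevisitEvent z r R₁ R₂ (1 / ((n : ℝ) + 1)))

theorem isClosed_thick (z : ℂ) (r R₁ R₂ : ℝ) (n : ℕ) : IsClosed (thick z r R₁ R₂ n) :=
  isClosed_closure

theorem antitone_thick (z : ℂ) (r R₁ R₂ : ℝ) : Antitone (thick z r R₁ R₂) := by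
  intro m n hmn
  have hmn' : (m : ℝ) ≤ n := by exact_mod_cast hmn
  refine closure_mono ?_
  rintro c ⟨γ, rfl, hγ⟩
  exact ⟨γ, rfl, nearRevisit_mono hγ (one_div_le_one_div_of_le (by positivity) (by linarith))⟩

theorem thick_core {z : ℂ} {r R₁ R₂ : ℝ} (h₁ : r < R₁) (c : CurveClass ℂ)
    (hc : ∀ n, c ∈ thick z r R₁ R₂ n) : c ∉ CurveClass.simple := fun hs =>
  not_mem_closure_nearRevisitEvent_forall_of_simple h₁ hs hc

/-- The lattice polyline event is contained in the pull-back of the closed thickening. -/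
theorem setOf_nearRevisit_subset (D : DobrushinDomain) (a b : ℝ → Site 2) (z : ℂ) (r R₁ R₂ : ℝ)
    (n : ℕ) (δ : ℝ) :
    {γ : SAW.DomainSAW D.carrier δ (a δ) (b δ) |
        NearRevisit (latticeCurve γ) z r R₁ R₂ (1 / ((n : ℝ) + 1))} ⊆
      {γ | γ.curve ∈ thick z r R₁ R₂ n} := by
  intro γ hγ
  show γ.curve ∈ thick z r R₁ R₂ n
  rw [← mk_latticeCurve]
  exact subset_closure ⟨latticeCurve γ, rfl, hγ⟩

/-! ## Necessity of stub 5 modulo tightness, and the summit certificate re-derived -/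

/-- **`NoTouchAt` follows from the crux under `EventualTight`.** -/
theorem noTouchAt_of_crux_of_eventualTight (hT : EventualTight) (hS : SimpleSubseqLimits)
    {D : DobrushinDomain} {a b : ℝ → Site 2} (hab : SAW.IsEndpointApprox D a b) : NoTouchAt D a b := by
  intro z r R hr hrR θ hθ
  set R₁ : ℝ := (r + R) / 2 with hR₁
  set R₂ : ℝ := R + 1 with hR₂
  have h₁ : r < R₁ := by rw [hR₁]; linarith
  have h₂ : R₁ < R := by rw [hR₁]; linarith
  have h₃ : R < R₂ := by rw [hR₂]; linarith
  obtain ⟨n, hn⟩ := exists_limsup_law_le_of_crux_of_not_simple hT hS hab (isClosed_thick z r R₁ R₂)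
    (antitone_thick z r R₁ R₂) (thick_core h₁) hθ
  refine ⟨1 / ((n : ℝ) + 1), R₁, R₂, by positivity, h₁, h₂, h₃, ?_⟩
  exact (limsup_le_limsup (Eventually.of_forall fun δ =>
    measure_mono (setOf_nearRevisit_subset D a b z r R₁ R₂ n δ))).trans hn

/-- **Stub 5 is NECESSARY for the crux modulo `EventualTight`** (registered signature as conclusion). -/
theorem stub_onePointNoTouch_of_crux_of_eventualTight (hT : EventualTight) (hS : SimpleSubseqLimits) :
    ∀ (D : DobrushinDomain) (a b : ℝ → Site 2), SAW.IsEndpointApprox D a b → NoTouchAt D a b :=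
  fun _ _ _ hab => noTouchAt_of_crux_of_eventualTight hT hS hab

/-- The gen-1 certificate re-derived from the landed summit principle: stub 5 is not over-strong. -/
theorem stub_onePointNoTouch_of_sawScalingLimit (h : _root_.SAWScalingLimit) :
    ∀ (D : DobrushinDomain) (a b : ℝ → Site 2), SAW.IsEndpointApprox D a b → NoTouchAt D a b := by
  intro D a b hab z r R hr hrR θ hθ
  set R₁ : ℝ := (r + R) / 2 with hR₁
  set R₂ : ℝ := R + 1 with hR₂
  have h₁ : r < R₁ := by rw [hR₁]; linarith
  have h₂ : R₁ < R := by rw [hR₁]; linarith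
  have h₃ : R < R₂ := by rw [hR₂]; linarith
  obtain ⟨n, hn⟩ := exists_limsup_law_le_of_sawScalingLimit_of_not_simple h hab
    (isClosed_thick z r R₁ R₂) (antitone_thick z r R₁ R₂) (thick_core h₁) hθ
  refine ⟨1 / ((n : ℝ) + 1), R₁, R₂, by positivity, h₁, h₂, h₃, ?_⟩
  exact (limsup_le_limsup (Eventually.of_forall fun δ =>
    measure_mono (setOf_nearRevisit_subset D a b z r R₁ R₂ n δ))).trans hn

end Summit.CriticalPhenomena.SAWScalingLimit.Cruxes.SimpleSubseqLimits.MarkedPointRevisit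

end
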